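import Literature.Probability.Percolation.ZdFiveArmSepERows
import HarnessLib

/-!
# Non-vacuity of Kesten's well-separated five-arm event `zdFiveArmSepE` at bounded ratio

Topic `Literature/Probability/Percolation`; bond percolation on `ℤ² = Site 2` at `p = 1/2`.
Corridor events (definitions) and PROOFS; no named fact.  The initial-scale input

  `(init)  ∃ c > 0, ∀ m ≥ 2048, ∀ N, 2m ≤ N ≤ 8m → c ≤ P_{1/2}(zdFiveArmSepE m N)`

(`exists_pos_le_real_zdFiveArmSepE`) of
`DuminilCopinManolescuTassion2021_zdFiveArm_upperBound_of_separationInputs`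
(`ZdFiveArmUpperBoundOfScheme.lean`), following `exists_pos_le_real_zdFourArmSep`
(`ZdFourArmSepNonvacuity.lean`): the corridor events of the two right arms `R⁺`, `R⁻`
(`zdSepCorrRp`, `zdSepCorrRm`, seven open crossings each, RSW at aspect ratio `≤ 1024`), their
pairs (columns `x₀ ≥ n - n/16`, hence disjoint from the dual corridors' pairs), the deterministic
step `mem_zdFiveArmSepE_of_corr` (the arms of `ZdFiveArmSepERows.lean` have carriers in rows
`≥ 1` resp. `≤ -1`, so their edge carriers are disjoint; the left arm and the dual arms are those
of the four-arm file), Harris within the increasing and the decreasing family and independence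
across.

## References

* P. Nolin, *Near-critical percolation in two dimensions*, EJP 13 (2008), §4.3 Prop. 12 (i),
  Prop. 14 (arXiv 0711.4948: Prop. 11 (i), Prop. 13) [Nolin2008].
* H. Kesten, *Scaling relations for 2D-percolation*, CMP 109 (1987), §2 (2.26)–(2.28), Lemma 4
  [KestenScalingCMP1987].
-/

noncomputable section

open SimpleGraph Finset

namespace Literature.Probability.Percolation

open LatticeModels _root_.MeasureTheory

/-! ### The corridor events of the two right arms -/

section Events

/-- The seven open corridor crossings producing the upper right arm `R⁺` (inner band base
`r₀ = n/4`, outer band base `N/4`). [cite: Nolin2008, §4.3 proof of Prop. 12 (i) (arXiv 0711.4948: Prop. 11 (i))] -/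
def zdSepCorrRp (n N : ℕ) : Set (BondConfig (Site 2)) :=
  lrCrossingAt ![(n : ℤ) - (n / 16 : ℕ), ((n / 4 : ℕ) : ℤ)] (2 * (n / 16)) (n / 64) ∩
    (tbCrossingAt' ![(n : ℤ) + 1, ((n / 4 : ℕ) : ℤ)] (n / 16 - 2) ((N / 4 - n / 4) + n / 64) ∩
      (lrCrossingAt ![(n : ℤ) + 1, ((n / 4 : ℕ) : ℤ)] (N - n - 2) ((N / 4 - n / 4) + n / 64) ∩
        (tbCrossingAt' ![(N : ℤ) - (N / 16 : ℕ) + 1, ((n / 4 : ℕ) : ℤ)] (N / 16 - 2) ((N / 4 - n / 4) + n / 64) ∩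
          (lrCrossingAt ![(N : ℤ) - (N / 16 : ℕ), ((n / 4 : ℕ) : ℤ) + ((N / 4 - n / 4) : ℕ)] (2 * (N / 16)) (n / 64) ∩
            (tbCrossingAt' ![(N : ℤ) + 1, ((n / 4 : ℕ) : ℤ) + ((N / 4 - n / 4) : ℕ) - ((N / 64 : ℕ) : ℤ)] (N / 16 - 2) (n / 64 + 2 * (N / 64)) ∩
              tbCrossingAt' ![(n : ℤ) - (n / 16 : ℕ) + 1, ((n / 4 : ℕ) : ℤ) - ((n / 64 : ℕ) : ℤ)] (n / 16 - 2) (3 * (n / 64)))))))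

/-- The seven open corridor crossings producing the lower right arm `R⁻` (inner band base
`r₀ = -(n/4 + n/64)`, outer band base `-(N/4 + N/64)`, descending). [cite: Nolin2008, §4.3 proof of Prop. 12 (i) (arXiv 0711.4948: Prop. 11 (i))] -/
def zdSepCorrRm (n N : ℕ) : Set (BondConfig (Site 2)) :=
  lrCrossingAt ![(n : ℤ) - (n / 16 : ℕ), (-(((n / 4 : ℕ) : ℤ) + ((n / 64 : ℕ) : ℤ)))] (2 * (n / 16)) (n / 64) ∩
    (tbCrossingAt' ![(n : ℤ) + 1, (-(((n / 4 : ℕ) : ℤ) + ((n / 64 : ℕ) : ℤ))) - (((N / 4 + N / 64) - (n / 4 + n / 64)) : ℕ)] (n / 16 - 2) (((N / 4 + N / 64) - (n / 4 + n / 64)) + n / 64) ∩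
      (lrCrossingAt ![(n : ℤ) + 1, (-(((n / 4 : ℕ) : ℤ) + ((n / 64 : ℕ) : ℤ))) - (((N / 4 + N / 64) - (n / 4 + n / 64)) : ℕ)] (N - n - 2) (((N / 4 + N / 64) - (n / 4 + n / 64)) + n / 64) ∩
        (tbCrossingAt' ![(N : ℤ) - (N / 16 : ℕ) + 1, (-(((n / 4 : ℕ) : ℤ) + ((n / 64 : ℕ) : ℤ))) - (((N / 4 + N / 64) - (n / 4 + n / 64)) : ℕ)] (N / 16 - 2) (((N / 4 + N / 64) - (n / 4 + n / 64)) + n / 64) ∩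
          (lrCrossingAt ![(N : ℤ) - (N / 16 : ℕ), (-(((n / 4 : ℕ) : ℤ) + ((n / 64 : ℕ) : ℤ))) - (((N / 4 + N / 64) - (n / 4 + n / 64)) : ℕ)] (2 * (N / 16)) (n / 64) ∩
            (tbCrossingAt' ![(N : ℤ) + 1, (-(((n / 4 : ℕ) : ℤ) + ((n / 64 : ℕ) : ℤ))) - (((N / 4 + N / 64) - (n / 4 + n / 64)) : ℕ) - ((N / 64 : ℕ) : ℤ)] (N / 16 - 2) (n / 64 + 2 * (N / 64)) ∩
              tbCrossingAt' ![(n : ℤ) - (n / 16 : ℕ) + 1, (-(((n / 4 : ℕ) : ℤ) + ((n / 64 : ℕ) : ℤ))) - ((n / 64 : ℕ) : ℤ)] (n / 16 - 2) (3 * (n / 64)))))))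

/-- The pairs read by the `R⁺` corridors. [folklore] -/
def zdSepCorrRpPairs (n N : ℕ) : Finset (Sym2 (Site 2)) :=
  ((rectangle (2 * (n / 16)) (n / 64)).image (· + (![(n : ℤ) - (n / 16 : ℕ), ((n / 4 : ℕ) : ℤ)] : Site 2))).sym2 ∪
    (((rectangle (n / 16 - 2) ((N / 4 - n / 4) + n / 64)).image (· + (![(n : ℤ) + 1, ((n / 4 : ℕ) : ℤ)] : Site 2))).sym2 ∪
      (((rectangle (N - n - 2) ((N / 4 - n / 4) + n / 64)).image (· + (![(n : ℤ) + 1, ((n / 4 : ℕ) : ℤ)] : Site 2))).sym2 ∪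
        (((rectangle (N / 16 - 2) ((N / 4 - n / 4) + n / 64)).image (· + (![(N : ℤ) - (N / 16 : ℕ) + 1, ((n / 4 : ℕ) : ℤ)] : Site 2))).sym2 ∪
          (((rectangle (2 * (N / 16)) (n / 64)).image (· + (![(N : ℤ) - (N / 16 : ℕ), ((n / 4 : ℕ) : ℤ) + ((N / 4 - n / 4) : ℕ)] : Site 2))).sym2 ∪
            (((rectangle (N / 16 - 2) (n / 64 + 2 * (N / 64))).image (· + (![(N : ℤ) + 1, ((n / 4 : ℕ) : ℤ) + ((N / 4 - n / 4) : ℕ) - ((N / 64 : ℕ) : ℤ)] : Site 2))).sym2 ∪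
              ((rectangle (n / 16 - 2) (3 * (n / 64))).image (· + (![(n : ℤ) - (n / 16 : ℕ) + 1, ((n / 4 : ℕ) : ℤ) - ((n / 64 : ℕ) : ℤ)] : Site 2))).sym2)))))

/-- The pairs read by the `R⁻` corridors. [folklore] -/
def zdSepCorrRmPairs (n N : ℕ) : Finset (Sym2 (Site 2)) :=
  ((rectangle (2 * (n / 16)) (n / 64)).image (· + (![(n : ℤ) - (n / 16 : ℕ), (-(((n / 4 : ℕ) : ℤ) + ((n / 64 : ℕ) : ℤ)))] : Site 2))).sym2 ∪
    (((rectangle (n / 16 - 2) (((N / 4 + N / 64) - (n / 4 + n / 64)) + n / 64)).image (· + (![(n : ℤ) + 1, (-(((n / 4 : ℕ) : ℤ) + ((n / 64 : ℕ) : ℤ))) - (((N / 4 + N / 64) - (n / 4 + n / 64)) : ℕ)] : Site 2))).sym2 ∪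
      (((rectangle (N - n - 2) (((N / 4 + N / 64) - (n / 4 + n / 64)) + n / 64)).image (· + (![(n : ℤ) + 1, (-(((n / 4 : ℕ) : ℤ) + ((n / 64 : ℕ) : ℤ))) - (((N / 4 + N / 64) - (n / 4 + n / 64)) : ℕ)] : Site 2))).sym2 ∪
        (((rectangle (N / 16 - 2) (((N / 4 + N / 64) - (n / 4 + n / 64)) + n / 64)).image (· + (![(N : ℤ) - (N / 16 : ℕ) + 1, (-(((n / 4 : ℕ) : ℤ) + ((n / 64 : ℕ) : ℤ))) - (((N / 4 + N / 64) - (n / 4 + n / 64)) : ℕ)] : Site 2))).sym2 ∪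
          (((rectangle (2 * (N / 16)) (n / 64)).image (· + (![(N : ℤ) - (N / 16 : ℕ), (-(((n / 4 : ℕ) : ℤ) + ((n / 64 : ℕ) : ℤ))) - (((N / 4 + N / 64) - (n / 4 + n / 64)) : ℕ)] : Site 2))).sym2 ∪
            (((rectangle (N / 16 - 2) (n / 64 + 2 * (N / 64))).image (· + (![(N : ℤ) + 1, (-(((n / 4 : ℕ) : ℤ) + ((n / 64 : ℕ) : ℤ))) - (((N / 4 + N / 64) - (n / 4 + n / 64)) : ℕ) - ((N / 64 : ℕ) : ℤ)] : Site 2))).sym2 ∪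
              ((rectangle (n / 16 - 2) (3 * (n / 64))).image (· + (![(n : ℤ) - (n / 16 : ℕ) + 1, (-(((n / 4 : ℕ) : ℤ) + ((n / 64 : ℕ) : ℤ))) - ((n / 64 : ℕ) : ℤ)] : Site 2))).sym2)))))

variable {n N : ℕ}

/-- The `R⁺` corridors are increasing. [folklore] -/
theorem isUpperSet_zdSepCorrRp (n N : ℕ) : IsUpperSet (zdSepCorrRp n N) :=
  isUpperSet_inter7 (isUpperSet_lrCrossingAt _ _ _) (isUpperSet_tbCrossingAt' _ _ _) (isUpperSet_lrCrossingAt _ _ _)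
    (isUpperSet_tbCrossingAt' _ _ _) (isUpperSet_lrCrossingAt _ _ _) (isUpperSet_tbCrossingAt' _ _ _)
    (isUpperSet_tbCrossingAt' _ _ _)

/-- The `R⁻` corridors are increasing. [folklore] -/
theorem isUpperSet_zdSepCorrRm (n N : ℕ) : IsUpperSet (zdSepCorrRm n N) :=
  isUpperSet_inter7 (isUpperSet_lrCrossingAt _ _ _) (isUpperSet_tbCrossingAt' _ _ _) (isUpperSet_lrCrossingAt _ _ _)
    (isUpperSet_tbCrossingAt' _ _ _) (isUpperSet_lrCrossingAt _ _ _) (isUpperSet_tbCrossingAt' _ _ _)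
    (isUpperSet_tbCrossingAt' _ _ _)

/-- The `R⁺` corridors are measurable. [folklore] -/
theorem measurableSet_zdSepCorrRp (n N : ℕ) : MeasurableSet (zdSepCorrRp n N) :=
  measurableSet_inter7 (measurableSet_lrCrossingAt _ _ _) (measurableSet_tbCrossingAt' _ _ _)
    (measurableSet_lrCrossingAt _ _ _) (measurableSet_tbCrossingAt' _ _ _) (measurableSet_lrCrossingAt _ _ _)
    (measurableSet_tbCrossingAt' _ _ _) (measurableSet_tbCrossingAt' _ _ _)

/-- The `R⁻` corridors are measurable. [folklore] -/
theorem measurableSet_zdSepCorrRm (n N : ℕ) : MeasurableSet (zdSepCorrRm n N) :=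
  measurableSet_inter7 (measurableSet_lrCrossingAt _ _ _) (measurableSet_tbCrossingAt' _ _ _)
    (measurableSet_lrCrossingAt _ _ _) (measurableSet_tbCrossingAt' _ _ _) (measurableSet_lrCrossingAt _ _ _)
    (measurableSet_tbCrossingAt' _ _ _) (measurableSet_tbCrossingAt' _ _ _)

/-- The `R⁺` corridors are determined by their pairs. [folklore] -/
theorem determinedBy_zdSepCorrRp (n N : ℕ) : DeterminedBy (zdSepCorrRp n N) ↑(zdSepCorrRpPairs n N) := by
  unfold zdSepCorrRp zdSepCorrRpPairs lrCrossingAt tbCrossingAt'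
  exact (determinedBy_openCrossing_image _ _ _ _).inter_finsetUnion
    ((determinedBy_openCrossing_image _ _ _ _).inter_finsetUnion
    ((determinedBy_openCrossing_image _ _ _ _).inter_finsetUnion
    ((determinedBy_openCrossing_image _ _ _ _).inter_finsetUnion
    ((determinedBy_openCrossing_image _ _ _ _).inter_finsetUnion
    ((determinedBy_openCrossing_image _ _ _ _).inter_finsetUnion
    (determinedBy_openCrossing_image _ _ _ _))))))

/-- The `R⁻` corridors are determined by their pairs. [folklore] -/
theorem determinedBy_zdSepCorrRm (n N : ℕ) : DeterminedBy (zdSepCorrRm n N) ↑(zdSepCorrRmPairs n N) := by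
  unfold zdSepCorrRm zdSepCorrRmPairs lrCrossingAt tbCrossingAt'
  exact (determinedBy_openCrossing_image _ _ _ _).inter_finsetUnion
    ((determinedBy_openCrossing_image _ _ _ _).inter_finsetUnion
    ((determinedBy_openCrossing_image _ _ _ _).inter_finsetUnion
    ((determinedBy_openCrossing_image _ _ _ _).inter_finsetUnion
    ((determinedBy_openCrossing_image _ _ _ _).inter_finsetUnion
    ((determinedBy_openCrossing_image _ _ _ _).inter_finsetUnion
    (determinedBy_openCrossing_image _ _ _ _))))))

set_option maxHeartbeats 2000000 in
/-- Sites of the `R⁺` corridor pairs lie in the columns `x₀ ≥ n - n/16`. [folklore] -/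
theorem zdSepCorrRpPairs_sites (hn : 64 ≤ n) (hnN : 2 * n ≤ N) {e : Sym2 (Site 2)} (he : e ∈ zdSepCorrRpPairs n N)
    {x : Site 2} (hx : x ∈ e) : (n : ℤ) - (n / 16 : ℕ) ≤ x 0 := by
  have h16 : ((N / 16 : ℕ) : ℤ) ≤ N - n := by
    have : N / 16 ≤ N - n := by omega
    have := (Nat.cast_le (α := ℤ)).2 this; push_cast [Nat.cast_sub (by omega : n ≤ N)] at this; exact this
  simp only [zdSepCorrRpPairs, Finset.mem_union] at he
  rcases he with he | he | he | he | he | he | he <;>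
    have h := apply_le_of_mem_rectanglePairs he hx <;>
    simp only [Matrix.cons_val_zero, Matrix.cons_val_one] at h <;> omega

set_option maxHeartbeats 2000000 in
/-- Sites of the `R⁻` corridor pairs lie in the columns `x₀ ≥ n - n/16`. [folklore] -/
theorem zdSepCorrRmPairs_sites (hn : 64 ≤ n) (hnN : 2 * n ≤ N) {e : Sym2 (Site 2)} (he : e ∈ zdSepCorrRmPairs n N)
    {x : Site 2} (hx : x ∈ e) : (n : ℤ) - (n / 16 : ℕ) ≤ x 0 := by
  have h16 : ((N / 16 : ℕ) : ℤ) ≤ N - n := by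
    have : N / 16 ≤ N - n := by omega
    have := (Nat.cast_le (α := ℤ)).2 this; push_cast [Nat.cast_sub (by omega : n ≤ N)] at this; exact this
  simp only [zdSepCorrRmPairs, Finset.mem_union] at he
  rcases he with he | he | he | he | he | he | he <;>
    have h := apply_le_of_mem_rectanglePairs he hx <;>
    simp only [Matrix.cons_val_zero, Matrix.cons_val_one] at h <;> omega

/-- **The increasing corridor pairs and the dual-corridor pairs are disjoint** (`2048 ≤ n`,
`2n ≤ N ≤ 8n`). [folklore] -/
theorem disjoint_zdSepCorr5Pairs (hn : 2048 ≤ n) (hnN : 2 * n ≤ N) (hN : N ≤ 8 * n) :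
    Disjoint (↑((zdSepCorrRpPairs n N ∪ zdSepCorrRmPairs n N) ∪ zdSepCorrRLPairs n N) : Set (Sym2 (Site 2)))
      ↑(zdSepCorrTBPairs n N) := by
  rw [Set.disjoint_left]
  intro e he he'
  obtain ⟨x, hx⟩ : ∃ x, x ∈ e := ⟨e.out.1, Sym2.out_fst_mem e⟩
  have h2 := zdSepCorrTBPairs_sites (Finset.mem_coe.1 he') hx
  have e1 : 2 * (n / 64) + N / 64 + 2 + n / 16 + 1 ≤ n := by omega
  have e1' : 2 * ((n / 64 : ℕ) : ℤ) + (N / 64 : ℕ) + 2 + (n / 16 : ℕ) + 1 ≤ n := by exact_mod_cast e1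
  rw [Finset.coe_union, Finset.coe_union, Set.mem_union, Set.mem_union] at he
  rcases he with (he | he) | he
  · have h1 := zdSepCorrRpPairs_sites (by omega) hnN he hx; omega
  · have h1 := zdSepCorrRmPairs_sites (by omega) hnN he hx; omega
  · have h1 := zdSepCorrRLPairs_sites (by omega) hnN he hx; omega

/-! ### The deterministic step -/

/-- Arithmetic of the `R⁻` row bands (kept out of the crowded context of the construction).
[folklore] -/
private theorem armRm_arith {n N : ℕ} (hn : 2048 ≤ n) (hnN : 2 * n ≤ N) (hN : N ≤ 8 * n) :
    ((((N / 4 + N / 64) - (n / 4 + n / 64) : ℕ)) : ℤ) = (N / 4 : ℕ) + (N / 64 : ℕ) - (n / 4 : ℕ) - (n / 64 : ℕ) ∧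
    N / 64 ≤ (N / 4 + N / 64) - (n / 4 + n / 64) + n / 64 ∧
    ((N / 4 : ℕ) : ℤ) + (N / 64 : ℕ) ≤ N ∧ ((n / 64 : ℕ) : ℤ) ≤ (n / 4 : ℕ) ∧ ((n / 64 : ℕ) : ℤ) ≤ (N / 64 : ℕ) ∧
    2 * ((n / 64 : ℕ) : ℤ) + 1 ≤ (n / 4 : ℕ) := by
  have h1 : n / 4 + n / 64 ≤ N / 4 + N / 64 := by omega
  refine ⟨?_, by omega, ?_, ?_, ?_, ?_⟩
  · push_cast [Nat.cast_sub h1]; ring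
  · have : N / 4 + N / 64 ≤ N := by omega
    exact_mod_cast this
  · have : n / 64 ≤ n / 4 := by omega
    exact_mod_cast this
  · have : n / 64 ≤ N / 64 := by omega
    exact_mod_cast this
  · have : 2 * (n / 64) + 1 ≤ n / 4 := by omega
    exact_mod_cast this

/-- Arithmetic of the corridor sizes. [folklore] -/
private theorem corr_arith {n N : ℕ} (hn : 2048 ≤ n) (hnN : 2 * n ≤ N) (hN : N ≤ 8 * n) :
    n / 16 - 2 + 2 = n / 16 ∧ N / 16 - 2 + 2 = N / 16 ∧ n + (N - n - 2) + 2 = N ∧ n / 16 + 1 ≤ n / 8 ∧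
    n / 64 + 1 ≤ n / 8 ∧ N / 16 + 1 ≤ N / 8 ∧ n + n / 16 ≤ N ∧ n + N / 16 ≤ N := by
  omega

set_option maxHeartbeats 1600000 in
/-- The upper right arm `R⁺` from its corridors, with carrier in the rows `≥ n/4 - n/64`. [cite: Nolin2008, §4.3 proof of Prop. 12 (i) (arXiv 0711.4948: Prop. 11 (i))] -/
theorem exists_armRp_of_corr (hn : 2048 ≤ n) (hnN : 2 * n ≤ N) (hN : N ≤ 8 * n) {ω : BondConfig (Site 2)}
    (hω : ω ⊆ (zdGraph 2).edgeSet) (h : ω ∈ zdSepCorrRp n N) :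
    ∃ A : ZdSepOpenArmR ω n N (n / 4 : ℕ) ((n / 4 : ℕ) + (n / 64 : ℕ)) (N / 4 : ℕ) ((N / 4 : ℕ) + (N / 64 : ℕ)),
      ∀ v ∈ A.carrier, ((n / 4 : ℕ) : ℤ) - (n / 64 : ℕ) ≤ v 1 := by
  obtain ⟨p₁, p₂, p₃, p₄, p₅, p₆, p₇⟩ := h
  have hD4 : n / 4 ≤ N / 4 := by omega
  have hD' : (((N / 4 - n / 4 : ℕ) : ℕ) : ℤ) = (N / 4 : ℕ) - (n / 4 : ℕ) := by push_cast [Nat.cast_sub hD4]; ring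
  have h6 : n / 4 + (N / 4 - n / 4) + n / 64 ≤ N := by omega
  have h7 : N / 64 ≤ N / 4 - n / 4 + n / 64 := by omega
  have hnN64 : ((n / 64 : ℕ) : ℤ) ≤ (N / 64 : ℕ) := by
    have : n / 64 ≤ N / 64 := by omega
    exact_mod_cast this
  have s3 : ((N / 4 : ℕ) : ℤ) ≤ ((n / 4 : ℕ) : ℤ) + (((N / 4 - n / 4) : ℕ) : ℤ) := by rw [hD']; linarith
  have s4 : ((n / 4 : ℕ) : ℤ) + (((N / 4 - n / 4) : ℕ) : ℤ) + ((n / 64 : ℕ) : ℤ) ≤ ((N / 4 : ℕ) : ℤ) + ((N / 64 : ℕ) : ℤ) := by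
    rw [hD']; linarith
  obtain ⟨hba, hBA, hL, h1, h2, h3, h4, h5⟩ := corr_arith hn hnN hN
  exact nonempty_zdSepOpenArmR_of_crossings_rows (n := n) (N := N) (a := n / 16) (b := n / 16 - 2) (A := N / 16)
    (B := N / 16 - 2) (L := N - n - 2) (r₀ := n / 4) (D := N / 4 - n / 4)
    hω hba hBA hL h1 h2 h3 (by omega) (by omega) h4 h5 h6 h7
    le_rfl le_rfl s3 s4 p₁ p₂ p₃ p₄ p₅ p₆ p₇

set_option maxHeartbeats 1600000 in
/-- The lower right arm `R⁻` from its corridors, with carrier in the rows `≤ -n/4 + n/64`. [cite: Nolin2008, §4.3 proof of Prop. 12 (i) (arXiv 0711.4948: Prop. 11 (i))] -/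
theorem exists_armRm_of_corr (hn : 2048 ≤ n) (hnN : 2 * n ≤ N) (hN : N ≤ 8 * n) {ω : BondConfig (Site 2)}
    (hω : ω ⊆ (zdGraph 2).edgeSet) (h : ω ∈ zdSepCorrRm n N) :
    ∃ B : ZdSepOpenArmR ω n N (-((n / 4 : ℕ) + (n / 64 : ℕ) : ℤ)) (-(n / 4 : ℕ))
        (-((N / 4 : ℕ) + (N / 64 : ℕ) : ℤ)) (-(N / 4 : ℕ)),
      ∀ v ∈ B.carrier, v 1 ≤ -(((n / 4 : ℕ) : ℤ) + ((n / 64 : ℕ) : ℤ)) + 2 * (n / 64 : ℕ) := by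
  obtain ⟨p₁, p₂, p₃, p₄, p₅, p₆, p₇⟩ := h
  obtain ⟨hDm', h7, hN4, hn4, hnN64, -⟩ := armRm_arith hn hnN hN
  obtain ⟨hba, hBA, hL, h1, h2, h3, h4, h5⟩ := corr_arith hn hnN hN
  have hNz : (0 : ℤ) ≤ N := by positivity
  -- the side conditions, over `ℤ`
  have s1 : -(((n / 4 : ℕ) : ℤ) + ((n / 64 : ℕ) : ℤ)) + ((n / 64 : ℕ) : ℤ) ≤ N := by linarith
  have s2 : -(N : ℤ) ≤ -(((n / 4 : ℕ) : ℤ) + ((n / 64 : ℕ) : ℤ)) - (((N / 4 + N / 64) - (n / 4 + n / 64) : ℕ) : ℤ) := by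
    rw [hDm']; linarith
  have s3 : -(((N / 4 : ℕ) : ℤ) + ((N / 64 : ℕ) : ℤ)) ≤
      -(((n / 4 : ℕ) : ℤ) + ((n / 64 : ℕ) : ℤ)) - (((N / 4 + N / 64) - (n / 4 + n / 64) : ℕ) : ℤ) := by
    rw [hDm']; linarith
  have s4 : -(((n / 4 : ℕ) : ℤ) + ((n / 64 : ℕ) : ℤ)) - (((N / 4 + N / 64) - (n / 4 + n / 64) : ℕ) : ℤ) + ((n / 64 : ℕ) : ℤ) ≤
      -((N / 4 : ℕ) : ℤ) := by
    rw [hDm']; linarith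
  have s5 : -(((n / 4 : ℕ) : ℤ) + ((n / 64 : ℕ) : ℤ)) + ((n / 64 : ℕ) : ℤ) ≤ -((n / 4 : ℕ) : ℤ) := by linarith
  exact nonempty_zdSepOpenArmR_of_crossings_rows' (n := n) (N := N) (a := n / 16) (b := n / 16 - 2) (A := N / 16)
    (B := N / 16 - 2) (L := N - n - 2) (r₀ := -(((n / 4 : ℕ) : ℤ) + ((n / 64 : ℕ) : ℤ)))
    (D := (N / 4 + N / 64) - (n / 4 + n / 64))
    hω hba hBA hL h1 h2 h3 (by omega) (by omega) h4 h5 s1 s2 h7 le_rfl s5 s3 s4 p₁ p₂ p₃ p₄ p₅ p₆ p₇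

/-- **On a lattice configuration the corridor crossings produce the well-separated five-arm event
`zdFiveArmSepE`**: the two right arms from the `R⁺`/`R⁻` corridors have carriers in the rows
`≥ n/4 - n/64 ≥ 1` resp. `≤ -n/4 + n/64 ≤ -1`, hence disjoint (edge) carriers; the left arm and the
two dual arms come from the corridors of `ZdFourArmSepNonvacuity.lean`. [cite: Nolin2008, §4.3 Prop. 14 with Prop. 12 (i) (arXiv 0711.4948: Prop. 13, Prop. 11 (i))] -/
theorem mem_zdFiveArmSepE_of_corr (hn : 2048 ≤ n) (hnN : 2 * n ≤ N) (hN : N ≤ 8 * n) {ω : BondConfig (Site 2)}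
    (hω : ω ⊆ (zdGraph 2).edgeSet)
    (h : ω ∈ (zdSepCorrRp n N ∩ (zdSepCorrRm n N ∩ (zdSepCorrR n N ∩ zdSepCorrL n N))) ∩
      (zdSepCorrT n N ∩ zdSepCorrB n N)) :
    ω ∈ zdFiveArmSepE n N := by
  obtain ⟨⟨hp, hm, hr, hl⟩, ht, hb⟩ := h
  obtain ⟨A, hA⟩ := exists_armRp_of_corr hn hnN hN hω hp
  obtain ⟨B, hB⟩ := exists_armRm_of_corr hn hnN hN hω hm
  have hAB : Disjoint A.carrier B.carrier := by
    rw [Set.disjoint_left]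
    intro v hvA hvB
    have h1 := hA v hvA
    have h2 := hB v hvB
    have h3' := (armRm_arith hn hnN hN).2.2.2.2.2
    linarith
  have h4 : ω ∈ (zdSepCorrR n N ∩ zdSepCorrL n N) ∩ (zdSepCorrT n N ∩ zdSepCorrB n N) := ⟨⟨hr, hl⟩, ht, hb⟩
  obtain ⟨⟨-, hL⟩, hT, hB'⟩ := mem_zdFourArmSep_of_corr hn hnN hω h4
  exact ⟨⟨⟨A, B, A.disjoint_edgeCarrier_of_disjoint_carrier B hAB⟩, hL⟩, hT, hB'⟩

end Events

/-! ### The lower bound -/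

section LowerBound

/-- **RSW lower bound for the `R⁺` corridors**: `P ≥ c⁷` (`2048 ≤ n`, `2n ≤ N ≤ 8n`; all seven
rectangles have aspect ratio `≤ 1024`). [cite: Nolin2008, §4.3 Prop. 14, lower bound (arXiv 0711.4948: Prop. 13)] -/
theorem le_real_zdSepCorrRp {n N : ℕ} {c : ℝ} (hc0 : 0 < c) (hc : ∀ l : ℕ, 1 ≤ l → c ≤ crossingProb half (1024 * l - 1) (l - 1))
    (hn : 2048 ≤ n) (hnN : 2 * n ≤ N) (hN : N ≤ 8 * n) :
    c ^ 7 ≤ (bondPercolation (zdGraph 2) half).real (zdSepCorrRp n N) :=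
  le_real_inter7_of_upper hc0.le (isUpperSet_lrCrossingAt _ _ _) (isUpperSet_tbCrossingAt' _ _ _)
    (isUpperSet_lrCrossingAt _ _ _) (isUpperSet_tbCrossingAt' _ _ _) (isUpperSet_lrCrossingAt _ _ _)
    (isUpperSet_tbCrossingAt' _ _ _) (isUpperSet_tbCrossingAt' _ _ _)
    (measurableSet_lrCrossingAt _ _ _) (measurableSet_tbCrossingAt' _ _ _) (measurableSet_lrCrossingAt _ _ _)
    (measurableSet_tbCrossingAt' _ _ _) (measurableSet_lrCrossingAt _ _ _) (measurableSet_tbCrossingAt' _ _ _)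
    (measurableSet_tbCrossingAt' _ _ _)
    (le_real_lrCrossingAt_of_rsw_ratio hc _ (by omega)) (le_real_tbCrossingAt'_of_rsw hc _ (by omega))
    (le_real_lrCrossingAt_of_rsw_ratio hc _ (by omega)) (le_real_tbCrossingAt'_of_rsw hc _ (by omega))
    (le_real_lrCrossingAt_of_rsw_ratio hc _ (by omega)) (le_real_tbCrossingAt'_of_rsw hc _ (by omega))
    (le_real_tbCrossingAt'_of_rsw hc _ (by omega))

/-- **RSW lower bound for the `R⁻` corridors**: `P ≥ c⁷`. [cite: Nolin2008, §4.3 Prop. 14, lower bound (arXiv 0711.4948: Prop. 13)] -/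
theorem le_real_zdSepCorrRm {n N : ℕ} {c : ℝ} (hc0 : 0 < c) (hc : ∀ l : ℕ, 1 ≤ l → c ≤ crossingProb half (1024 * l - 1) (l - 1))
    (hn : 2048 ≤ n) (hnN : 2 * n ≤ N) (hN : N ≤ 8 * n) :
    c ^ 7 ≤ (bondPercolation (zdGraph 2) half).real (zdSepCorrRm n N) :=
  le_real_inter7_of_upper hc0.le (isUpperSet_lrCrossingAt _ _ _) (isUpperSet_tbCrossingAt' _ _ _)
    (isUpperSet_lrCrossingAt _ _ _) (isUpperSet_tbCrossingAt' _ _ _) (isUpperSet_lrCrossingAt _ _ _)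
    (isUpperSet_tbCrossingAt' _ _ _) (isUpperSet_tbCrossingAt' _ _ _)
    (measurableSet_lrCrossingAt _ _ _) (measurableSet_tbCrossingAt' _ _ _) (measurableSet_lrCrossingAt _ _ _)
    (measurableSet_tbCrossingAt' _ _ _) (measurableSet_lrCrossingAt _ _ _) (measurableSet_tbCrossingAt' _ _ _)
    (measurableSet_tbCrossingAt' _ _ _)
    (le_real_lrCrossingAt_of_rsw_ratio hc _ (by omega)) (le_real_tbCrossingAt'_of_rsw hc _ (by omega))
    (le_real_lrCrossingAt_of_rsw_ratio hc _ (by omega)) (le_real_tbCrossingAt'_of_rsw hc _ (by omega))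
    (le_real_lrCrossingAt_of_rsw_ratio hc _ (by omega)) (le_real_tbCrossingAt'_of_rsw hc _ (by omega))
    (le_real_tbCrossingAt'_of_rsw hc _ (by omega))

/-- **Non-vacuity of the well-separated five-arm event `zdFiveArmSepE` at bounded ratio** (Nolin
2008, Prop. 14 [arXiv Prop. 13], lower bound, `j = 5`, `σ = BWBBW`, bond-`ℤ²`, `N/n ≤ 8`): there
is `c > 0` with `c ≤ P_{1/2}(zdFiveArmSepE n N)` for all `n ≥ 2048` and `2n ≤ N ≤ 8n` — the
twenty-eight open corridors (`R⁺`, `R⁻`, the unused straight `R`, `L`) and the fourteen dual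
corridors (`T`, `B`) are independent (disjoint pair sets), each family has probability `≥ c₀²⁸`
resp. `≥ c₀¹⁴` by Harris and RSW, and together they produce the event on lattice configurations
(`mem_zdFiveArmSepE_of_corr`).  This is the initial-scale input `(init)` of
`DuminilCopinManolescuTassion2021_zdFiveArm_upperBound_of_separationInputs`. [cite: Nolin2008, §4.3 Prop. 14, lower bound, with Prop. 12 (i) and §8.1 (arXiv 0711.4948: Prop. 13, Prop. 11 (i))] [cite: KestenScalingCMP1987, §2 Lemma 2 and (2.26)–(2.28)] -/
theorem exists_pos_le_real_zdFiveArmSepE :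
    ∃ c : ℝ, 0 < c ∧ ∀ n N : ℕ, 2048 ≤ n → 2 * n ≤ N → N ≤ 8 * n →
      c ≤ (bondPercolation (zdGraph 2) half).real (zdFiveArmSepE n N) := by
  obtain ⟨c, hc0, hc⟩ := rsw_lowerBound_holds 1024 (by norm_num)
  refine ⟨c ^ 7 * (c ^ 7 * (c ^ 7 * c ^ 7)) * (c ^ 7 * c ^ 7), by positivity, fun n N hn hnN hN => ?_⟩
  set μ := bondPercolation (zdGraph 2) half with hμ
  have hRL : c ^ 7 * c ^ 7 ≤ μ.real (zdSepCorrR n N ∩ zdSepCorrL n N) :=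
    le_real_inter_of_upper (by positivity) (by positivity) (isUpperSet_zdSepCorrR n N) (isUpperSet_zdSepCorrL n N)
      (measurableSet_zdSepCorrR n N) (measurableSet_zdSepCorrL n N) (le_real_zdSepCorrR hc0 hc hn hnN hN)
      (le_real_zdSepCorrL hc0 hc hn hnN hN)
  have hRmRL : c ^ 7 * (c ^ 7 * c ^ 7) ≤ μ.real (zdSepCorrRm n N ∩ (zdSepCorrR n N ∩ zdSepCorrL n N)) :=
    le_real_inter_of_upper (by positivity) (by positivity) (isUpperSet_zdSepCorrRm n N)
      ((isUpperSet_zdSepCorrR n N).inter (isUpperSet_zdSepCorrL n N)) (measurableSet_zdSepCorrRm n N)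
      ((measurableSet_zdSepCorrR n N).inter (measurableSet_zdSepCorrL n N)) (le_real_zdSepCorrRm hc0 hc hn hnN hN) hRL
  have hInc : c ^ 7 * (c ^ 7 * (c ^ 7 * c ^ 7)) ≤
      μ.real (zdSepCorrRp n N ∩ (zdSepCorrRm n N ∩ (zdSepCorrR n N ∩ zdSepCorrL n N))) :=
    le_real_inter_of_upper (by positivity) (by positivity) (isUpperSet_zdSepCorrRp n N)
      ((isUpperSet_zdSepCorrRm n N).inter ((isUpperSet_zdSepCorrR n N).inter (isUpperSet_zdSepCorrL n N)))
      (measurableSet_zdSepCorrRp n N)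
      ((measurableSet_zdSepCorrRm n N).inter ((measurableSet_zdSepCorrR n N).inter (measurableSet_zdSepCorrL n N)))
      (le_real_zdSepCorrRp hc0 hc hn hnN hN) hRmRL
  have hTB : c ^ 7 * c ^ 7 ≤ μ.real (zdSepCorrT n N ∩ zdSepCorrB n N) :=
    le_real_inter_of_lower (by positivity) (by positivity) (isLowerSet_zdSepCorrT n N) (isLowerSet_zdSepCorrB n N)
      (measurableSet_zdSepCorrT n N) (measurableSet_zdSepCorrB n N) (le_real_zdSepCorrT hc0 hc hn hnN hN)
      (le_real_zdSepCorrB hc0 hc hn hnN hN)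
  have hdet : DeterminedBy (zdSepCorrRp n N ∩ (zdSepCorrRm n N ∩ (zdSepCorrR n N ∩ zdSepCorrL n N)))
      ↑((zdSepCorrRpPairs n N ∪ zdSepCorrRmPairs n N) ∪ zdSepCorrRLPairs n N) := by
    have := (determinedBy_zdSepCorrRp n N).inter_finsetUnion
      ((determinedBy_zdSepCorrRm n N).inter_finsetUnion (determinedBy_zdSepCorrRL n N))
    rwa [← Finset.union_assoc] at this
  have hmeasInc : MeasurableSet (zdSepCorrRp n N ∩ (zdSepCorrRm n N ∩ (zdSepCorrR n N ∩ zdSepCorrL n N))) :=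
    (measurableSet_zdSepCorrRp n N).inter ((measurableSet_zdSepCorrRm n N).inter
      ((measurableSet_zdSepCorrR n N).inter (measurableSet_zdSepCorrL n N)))
  have hind : μ.real ((zdSepCorrRp n N ∩ (zdSepCorrRm n N ∩ (zdSepCorrR n N ∩ zdSepCorrL n N))) ∩
      (zdSepCorrT n N ∩ zdSepCorrB n N)) =
      μ.real (zdSepCorrRp n N ∩ (zdSepCorrRm n N ∩ (zdSepCorrR n N ∩ zdSepCorrL n N))) *
        μ.real (zdSepCorrT n N ∩ zdSepCorrB n N) :=
    bondPercolation_real_inter_of_disjoint (zdGraph 2) half (disjoint_zdSepCorr5Pairs hn hnN hN) hdet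
      (determinedBy_zdSepCorrTB n N) hmeasInc ((measurableSet_zdSepCorrT n N).inter (measurableSet_zdSepCorrB n N))
  calc c ^ 7 * (c ^ 7 * (c ^ 7 * c ^ 7)) * (c ^ 7 * c ^ 7)
      ≤ μ.real (zdSepCorrRp n N ∩ (zdSepCorrRm n N ∩ (zdSepCorrR n N ∩ zdSepCorrL n N))) *
          μ.real (zdSepCorrT n N ∩ zdSepCorrB n N) :=
        mul_le_mul hInc hTB (by positivity) measureReal_nonneg
    _ = μ.real ((zdSepCorrRp n N ∩ (zdSepCorrRm n N ∩ (zdSepCorrR n N ∩ zdSepCorrL n N))) ∩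
          (zdSepCorrT n N ∩ zdSepCorrB n N)) := hind.symm
    _ ≤ μ.real (zdFiveArmSepE n N) := by
        refine ENNReal.toReal_mono (measure_ne_top _ _) (measure_mono_ae ?_)
        have hae : ∀ᵐ ω ∂μ, ω ⊆ (zdGraph 2).edgeSet := ProbabilityTheory.setBernoulli_ae_subset
        filter_upwards [hae] with ω hω h
        exact mem_zdFiveArmSepE_of_corr hn hnN hN hω h

/-- **The initial-scale input `(init)` of the five-arm separation scheme**, in the shape consumed by
`DuminilCopinManolescuTassion2021_zdFiveArm_upperBound_of_separationInputs` (`n₁ = 2048`). [cite: Nolin2008, §4.3 Prop. 14, lower bound (arXiv 0711.4948: Prop. 13)] -/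
theorem exists_pos_le_real_zdFiveArmSepE_init :
    ∃ c : ℝ, 0 < c ∧ ∀ m N' : ℕ, 2048 ≤ m → 2 * m ≤ N' → N' ≤ 8 * m →
      c ≤ (bondPercolation (zdGraph 2) half).real (zdFiveArmSepE m N') :=
  exists_pos_le_real_zdFiveArmSepE

end LowerBound

end Literature.Probability.Percolation

end
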